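import Summits.QuantumFields.BalabanUV.T4Continuum.Support.NE9SpeciesFrameOfRecord

/-!
# NE9SpeciesFrameConvention — the species index frame of record GENERIC IN THE BOX CONVENTION (anchor `□̃⁴`, window `□̃²`,
# `□₀ = □̃⁵` as finite cube families of bounded size around a box), its level counts `LevelCountsG` from LETTERS ONLY for
# anchors of up to `10¹²` cubes, G1, and the TWO conventions as instances: the single-cube reading of generation 36's first cut
# (`NE9SpeciesFrameOfRecord`: odd balls 5⁴ ∕ 9⁴ ∕ 11⁴) and **PRINT'S COVER** ([I] p. 270 ll. 12–14 «We construct a cover of the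
# space T by cubes □, which are unions of 2ᵈ neighbouring cubes from π_k»): EVEN BLOCKS `□̃² = 6⁴`, `□̃⁴ = 10⁴`, `□₀ = □̃⁵ = 12⁴`
# π_k-cubes — the letters print's own counts show ([II] p. 8 «(6L)⁴L^jη», (1.27) «8·12³») — cell `pub-balaban`, T4-DAG §2 node U3 ∕
# §6 NE9; BINDER row NE9 OWNER lineage `b2b-balaban-t4-ne9-p1`, generation 36, LOCATED SELF-CORRECTION O-ne9p1g36-1; nothing of
# any import modified

HONEST FRAMING (T4-DAG PAGE 1).  Rung (B)+1 of the FINITE-VOLUME T⁴ programme — NOT infinite volume, NOT a mass gap, NOT the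
Clay problem.  NE9 (`T4OutputRate.NE9` ∧ `FadingMemory`) is a cell NEW ESTIMATE, NOT PRINTED in [I] = [Balaban1987RG1]
(CMP **109**), [II] = [Balaban1988RG2Cluster] (CMP **116**), and NOT PROVED for Bałaban's E^{(j)} («NE9 ⇐ the named binders»;
spine PROVED 0∕9).  HONEST DEPENDENCY (cell line, verbatim): continuum YM on T⁴ ⇐ BetaPertH ∧ nine spine estimates (0/9 proved);
BetaPertH ⇐ (D1) ∧ (D4) ∧ CAP+tail; G-an2-4 gates asym, D1 and NE2/3/4.  `FlowStep.BetaPertH`, (B), (B^μ) do not occur.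
LATTICE BOOKKEEPING; [I]∕[II] quoted for the TYPES of the index sets only (ABSOLUTE RULE: nothing printed is asserted); 0 sorry.

LOCATED SELF-CORRECTION O-ne9p1g36-1 (owner, same generation as `NE9SpeciesFrameOfRecord` p229933).  That module read print's
«□» as ONE cube of `π_k` and its enlargements `□̃ⁿ` as the centred sup-balls of `(2n+1)⁴` cubes (window 5⁴ = 625, anchor 9⁴ = 6561 —
also the letter of «LC-127» `NE9LevelCountsAnimal.smallness_four_of_le` —, `□₀` 11⁴).  Print's «□» is the 2ᵈ-BLOCK of the COVER of
[I] p. 270 (partition of unity `ζ_□`, centres on the `M`-lattice, so the boxes are still indexed by the cubes of `π_k` — `boxes` is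
unchanged), and `X̃ⁿ` adds `n` LAYERS of `π`-cubes ([I] p. 262 last ¶); hence `□̃² = 6⁴ = 1296` cubes (print: «This yields (6L)⁴L^jη»),
`□̃⁴ = 10⁴`, `□₀ = □̃⁵ = 12⁴ = 20736`.  The single-cube frame UNDER-COUNTS the sources `X ⊂ □̃²` and the families `Y₀ ⊇ □̃⁴` of (1.23);
nothing landed is false (every theorem of p229933 ∕ p230386 ∕ p230893 ∕ p231683 ∕ p232332 is about the frame it names), but the frame
that deserves the name «of record» is print's.  THIS FILE makes the frame GENERIC in the convention and instantiates BOTH: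
* §1 `BoxConvention R` — DATA: `anchor ∕ window ∕ box0 : (k : ℕ) → SCube R → Finset (π_k-cubes)` with size letters `nA nW nB` and the
  four structural facts (anchor nonempty, the three cardinality bounds); `cubeBlock n c` (the EVEN block `{c + v − n : v ∈ [0, 2n+1]⁴}`,
  `card ≤ (2n+2)⁴`, `c ∈ cubeBlock n c`); the instances **`ballConvention`** (generation 36's first cut) and **`printConvention`**
  ([I] p. 270 ∕ p. 262 ∕ p. 273, [II] pp. 4, 7–8);
* §2 the frame at a convention `𝔟`: `famC 𝔟 k Y a` (torus-face-connected `Y₀` with `𝔟.anchor ⊆ Y₀`, `Y₀ ∪ 𝔟.box0 = cubes_k(Y)`),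
  `volC`, `srcC` (`X ∈ 𝐃_j` coarsening into `𝔟.window`, re∕im doubled, live scales), `cntC`, `fibC`; §3 their readings by construction;
* §4 `smallness_four_of_card_le` (κ₁ ≥ 69 ⇒ the two (1.27) smallness conditions for anchors of `≤ 10¹²` cubes), `sumY_conv`, and
  **`levelCountsG_conv`** ∕ **`levelCountsG_conv_gain`**: `LevelCountsG P κ κ₁ (2·(2²⁰+1)) c_Q …` for any piece frame with these index
  fields, LETTERS ONLY (κ ≥ 144, κ₁ ≥ 69, `𝔟.nA ≤ 10¹²`, `𝔟.nW ≤ c_Q`, gain letters) — «LC-REC» + «LC-WINDOW» + the (1.27) sum composed BY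
  NAME with every reading discharged;
* §5 **`one_add_d_le_volC`**: G1 at the frame, `1 + d_k(Y) ≤ (1 + nA + nB) + 4·vol`.
DISGUISE TEST: finite-set bookkeeping; the conventions are displayed with loci; no inequality of the series.

References (TYPES ∕ loci only): [Balaban1987RG1] T. Bałaban, CMP **109** (1987) 249–301, p. 262 (layers), p. 270 (the cover by 2ᵈ-blocks,
`ζ_□`), p. 273 («□₀ = □̃⁵»), p. 274 (`ζ̃_□ = 1` on `□̃³`, `0` outside `□̃⁴`); [Balaban1988RG2Cluster] T. Bałaban, CMP **116** (1988) 1–22,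
pp. 3–4 (`σ₀`, `Y(σ) = □̃⁴ ∪ …`, `Y₀`), p. 7 («Y = Y₀ ∪ □₀»), p. 8 («X ⊂ □̃²», «(6L)⁴», (1.26)–(1.28)).  Summits-side NEW work (LEAN
PLACEMENT RULE); imports `NE9SpeciesFrameOfRecord` (p229933) ONLY; modifies nothing.  Value = the frame of record in print's own
combinatorics with its counts closed in the kernel, NOT summit progress.
-/

noncomputable section

open scoped BigOperators

namespace Summit.QuantumFields.BalabanUV.T4Continuum.NE9SpeciesFrameConvention

open Literature.MathematicalPhysics.QuantumFieldTheory.Balaban1983to89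
open Literature.MathematicalPhysics.QuantumFieldTheory.Balaban1983to89.T4OutputRate (Carriers)
open Literature.MathematicalPhysics.QuantumFieldTheory.Balaban1983to89.TreeLengthTorus (TPt TFaceConnected TDom)
open Summit.QuantumFields.BalabanUV.T4Continuum.B13Carriers (TwoRuns)
open Summit.QuantumFields.BalabanUV.T4Continuum.B13DomainGeometryTR
open Summit.QuantumFields.BalabanUV.T4Continuum.B13InnerData (coarsen)
open Summit.QuantumFields.BalabanUV.T4Continuum.NE9ComplexEncoding (doubleCarriers)
open Summit.QuantumFields.BalabanUV.T4Continuum.NE9Lemma1Counting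
open Summit.QuantumFields.BalabanUV.T4Continuum.NE9Lemma1Gain
open Summit.QuantumFields.BalabanUV.T4Continuum.NE9LevelCountsRecord (multiplicity_fst_le_two levelCountsG_of_record)
open Summit.QuantumFields.BalabanUV.T4Continuum.NE9LevelCountsAnimal (sumY_torus_le_exp_one)
open Summit.QuantumFields.BalabanUV.T4Continuum.NE9LevelCountsWindow (cover_of_window countQ_of_window countQ_of_window_agePow)
open Summit.QuantumFields.BalabanUV.T4Continuum.NE9SpeciesFrameOfRecord

/-! ## §1 Box conventions: even blocks, the two instances -/

section Torus

variable {N : ℕ}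

/-- [folklore] DATA: the EVEN block `{c + v − n : v ∈ [0, 2n+1]⁴}` — the 2⁴-block `{c, c+1}⁴` enlarged by `n` layers
([Balaban1987RG1] p. 270 «cubes □, which are unions of 2ᵈ neighbouring cubes from π_k», p. 262 «taking away two layers of cubes»). -/
def cubeBlock (n : ℕ) (c : TPt 4 N) : Finset (TPt 4 N) :=
  (Finset.univ : Finset (Fin 4 → Fin (2 * n + 2))).image fun v i => c i + ((v i : ℕ) : ZMod N) - (n : ZMod N)

/-- [folklore] `#cubeBlock n c ≤ (2n+2)⁴`. -/
theorem card_cubeBlock_le (n : ℕ) (c : TPt 4 N) : (cubeBlock n c).card ≤ (2 * n + 2) ^ 4 := by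
  refine Finset.card_image_le.trans ?_
  simp [Finset.card_univ, Fintype.card_pi]

/-- [folklore] The named cube lies in its block. -/
theorem mem_cubeBlock_self (n : ℕ) (c : TPt 4 N) : c ∈ cubeBlock n c := by
  refine Finset.mem_image.2 ⟨fun _ => ⟨n, by omega⟩, Finset.mem_univ _, ?_⟩
  funext i
  simp

end Torus

section Record

variable {G : Type} [GaugeGroup G] (R : TwoRuns G)

/-- [folklore] DATA: **A BOX CONVENTION** — for every scale `k` and box `a` (a cube of `π_k`, as a sigma cube) the three finite cube
families print attaches to it: the ANCHOR `□̃⁴` ([Balaban1988RG2Cluster] p. 4), the WINDOW `□̃²` (p. 8) and `□₀ = □̃⁵` ([Balaban1987RG1]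
p. 273), with size letters and the four structural facts the counts use.  No inequality of the series inside. -/
structure BoxConvention where
  /-- `□̃⁴` -/
  anchor : (k : ℕ) → SCube R → Finset (TPt 4 (R.cubesPerDir k))
  /-- `□̃²` -/
  window : (k : ℕ) → SCube R → Finset (TPt 4 (R.cubesPerDir k))
  /-- `□₀ = □̃⁵` -/
  box0 : (k : ℕ) → SCube R → Finset (TPt 4 (R.cubesPerDir k))
  /-- size letters -/
  nA : ℕ
  nW : ℕ
  nB : ℕ
  anchor_nonempty : ∀ k a, (anchor k a).Nonempty
  anchor_card : ∀ k a, (anchor k a).card ≤ nA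
  window_card : ∀ k a, (window k a).card ≤ nW
  box0_card : ∀ k a, (box0 k a).card ≤ nB

/-- [folklore] DATA: THE SINGLE-CUBE CONVENTION of `NE9SpeciesFrameOfRecord` (centred odd balls: window 5⁴, anchor 9⁴, `□₀` 11⁴). -/
def ballConvention : BoxConvention R where
  anchor := fun k a => anchor R k a
  window := fun k a => window R k a
  box0 := fun k a => box5 R k a
  nA := 6561
  nW := 625
  nB := 14641
  anchor_nonempty := fun k a => (anchor_nonempty_card_le k a).1
  anchor_card := fun k a => (anchor_nonempty_card_le k a).2
  window_card := fun k a => (card_cubeBall_le 2 _).trans (by norm_num)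
  box0_card := fun k a => card_box5_le k a

/-- [folklore] DATA: **PRINT'S CONVENTION** — «□» the 2⁴-BLOCK of the cover of [Balaban1987RG1] p. 270, `□̃ⁿ` with `n` layers added
(p. 262): EVEN blocks, window `□̃² = 6⁴ = 1296` cubes ([Balaban1988RG2Cluster] p. 8 «(6L)⁴»), anchor `□̃⁴ = 10⁴`, `□₀ = □̃⁵ = 12⁴ = 20736`
(p. 8 «8·12³»). [cite: Balaban1987RG1, §3 p.270 and §1 p.262; Balaban1988RG2Cluster, (1.26)-(1.28) p.8] -/
def printConvention : BoxConvention R where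
  anchor := fun k a => cubeBlock 4 (cubeAt R k a)
  window := fun k a => cubeBlock 2 (cubeAt R k a)
  box0 := fun k a => cubeBlock 5 (cubeAt R k a)
  nA := 10000
  nW := 1296
  nB := 20736
  anchor_nonempty := fun k a => ⟨_, mem_cubeBlock_self 4 (cubeAt R k a)⟩
  anchor_card := fun k a => (card_cubeBlock_le 4 _).trans (by norm_num)
  window_card := fun k a => (card_cubeBlock_le 2 _).trans (by norm_num)
  box0_card := fun k a => (card_cubeBlock_le 5 _).trans (by norm_num)

/-! ## §2 The frame at a convention -/

variable (𝔟 : BoxConvention R)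

open Classical in
/-- [folklore] DATA: the families `Y₀` of a box in the output domain `Y` at the convention: torus-face-connected scale-`k` families with
`□̃⁴ ⊆ Y₀` and `Y₀ ∪ □₀ = cubes_k(Y)` ([Balaban1988RG2Cluster] p. 4, p. 7 «Y = Y₀ ∪ □₀»). -/
def famC (k : ℕ) (Y : R.carriers.Dom) (a : SCube R) : Finset (Finset (SCube R)) :=
  ((Finset.univ : Finset (Finset (TPt 4 (R.cubesPerDir k)))).filter fun S =>
      𝔟.anchor k a ⊆ S ∧ TFaceConnected S ∧ S ∪ 𝔟.box0 k a = cubesOf R k (footprint Y)).map (familyEmb R k)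

/-- [folklore] DATA: the paid volume `M⁻⁴|Y₀ ∖ □̃⁴|` at the convention. -/
def volC (k : ℕ) (a : SCube R) (b : Finset (SCube R)) : ℝ := ((cubesOf R k b \ 𝔟.anchor k a).card : ℝ)

/-- [folklore] DATA: the sources `X ∈ 𝐃_j`, `X ⊂ □̃²` (coarsening into the window), re∕im doubled, live scales only. -/
def srcC (k : ℕ) (a : SCube R) (j : ℕ) : Finset (R.carriers.Dom × Bool) :=
  if j ≤ k ∧ k + R.m' ≤ R.F.m + R.K then
    ((R.domAt j).filter fun X => ∀ c ∈ footprint X, coarsen R c.1 k c.2 ∈ 𝔟.window k a) ×ˢ (Finset.univ : Finset Bool)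
  else ∅

/-- [folklore] DATA: the counting cubes `□′ ∈ π_j`, `□′ ⊂ □̃²` at the convention. -/
def cntC (k : ℕ) (a : SCube R) (j : ℕ) : Finset (SCube R) :=
  if j ≤ k ∧ k + R.m' ≤ R.F.m + R.K then
    ((Finset.univ : Finset (TPt 4 (R.cubesPerDir j))).filter fun p => coarsen R j k p ∈ 𝔟.window k a).map (embed R j)
  else ∅

/-- [folklore] DATA: the fibres `X ⊃ □′` at the convention. -/
def fibC (k : ℕ) (a : SCube R) (j : ℕ) (q : SCube R) : Finset (R.carriers.Dom × Bool) :=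
  (srcC R 𝔟 k a j).filter fun x => (⟨j, cubeAt R j q⟩ : SCube R) ∈ footprint x.1

/-! ## §3 The readings, by construction -/

variable {R 𝔟}

/-- [folklore] Membership in the families (unfolded). -/
theorem mem_famC {k : ℕ} {Y : R.carriers.Dom} {a : SCube R} {b : Finset (SCube R)} :
    b ∈ famC R 𝔟 k Y a ↔ ∃ S : Finset (TPt 4 (R.cubesPerDir k)),
      (𝔟.anchor k a ⊆ S ∧ TFaceConnected S ∧ S ∪ 𝔟.box0 k a = cubesOf R k (footprint Y)) ∧ S.map (embed R k) = b := by
  classical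
  simp only [famC, Finset.mem_map, Finset.mem_filter, Finset.mem_univ, true_and, familyEmb_apply]

/-- [folklore] A family reads back its cube set. -/
theorem cubesOf_of_mem_famC {k : ℕ} {Y : R.carriers.Dom} {a : SCube R} {b : Finset (SCube R)} (hb : b ∈ famC R 𝔟 k Y a) :
    𝔟.anchor k a ⊆ cubesOf R k b ∧ (cubesOf R k b).Nonempty ∧ TFaceConnected (cubesOf R k b) ∧
      cubesOf R k b ∪ 𝔟.box0 k a = cubesOf R k (footprint Y) := by
  obtain ⟨S, ⟨hA, hC, hU⟩, rfl⟩ := mem_famC.1 hb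
  rw [cubesOf_map_embed]
  exact ⟨hA, (𝔟.anchor_nonempty k a).mono hA, hC, hU⟩

/-- [folklore] `cubesOf k` is injective on the families. -/
theorem injOn_cubesOf_famC (k : ℕ) (Y : R.carriers.Dom) (a : SCube R) : Set.InjOn (cubesOf R k) ↑(famC R 𝔟 k Y a) := by
  intro b₁ hb₁ b₂ hb₂ h
  obtain ⟨S₁, -, rfl⟩ := mem_famC.1 hb₁
  obtain ⟨S₂, -, rfl⟩ := mem_famC.1 hb₂
  rw [cubesOf_map_embed, cubesOf_map_embed] at h
  rw [h]

/-- [folklore] Membership in the sources (unfolded). -/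
theorem mem_srcC {k : ℕ} {a : SCube R} {j : ℕ} {x : R.carriers.Dom × Bool} :
    x ∈ srcC R 𝔟 k a j ↔ (j ≤ k ∧ k + R.m' ≤ R.F.m + R.K) ∧ x.1 ∈ R.domAt j ∧
      ∀ c ∈ footprint x.1, coarsen R c.1 k c.2 ∈ 𝔟.window k a := by
  unfold srcC
  split_ifs with h
  · rw [Finset.mem_product, Finset.mem_filter]
    simp only [Finset.mem_univ, and_true, h, true_and]
  · simp only [Finset.notMem_empty, h, false_and]

/-- [folklore] Membership in the counting cubes (unfolded). -/
theorem mem_cntC {k : ℕ} {a : SCube R} {j : ℕ} {q : SCube R} :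
    q ∈ cntC R 𝔟 k a j ↔ (j ≤ k ∧ k + R.m' ≤ R.F.m + R.K) ∧
      ∃ p : TPt 4 (R.cubesPerDir j), coarsen R j k p ∈ 𝔟.window k a ∧ (⟨j, p⟩ : SCube R) = q := by
  unfold cntC
  split_ifs with h
  · simp [h]
  · simp [h]

/-- [folklore] Membership in a fibre (unfolded). -/
theorem mem_fibC {k : ℕ} {a : SCube R} {j : ℕ} {q : SCube R} {x : R.carriers.Dom × Bool} :
    x ∈ fibC R 𝔟 k a j q ↔ x ∈ srcC R 𝔟 k a j ∧ (⟨j, cubeAt R j q⟩ : SCube R) ∈ footprint x.1 := Finset.mem_filter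

/-- [folklore] The sources have the creation step of their slot. -/
theorem scale_of_mem_srcC {k : ℕ} {a : SCube R} {j : ℕ} {x : R.carriers.Dom × Bool} (hx : x ∈ srcC R 𝔟 k a j) :
    R.carriers.scale x.1 = j :=
  (TwoRuns.mem_domAt R).1 (mem_srcC.1 hx).2.1

/-! ## §4 The level counts at a convention — letters only -/

/-- [folklore] **NUMERALS, d = 4, for ANY anchor of at most `10¹²` cubes**: for `a ≥ 34` (i.e. κ₁ ≥ 69 at `a = ½(κ₁−1)`) both (1.27)
smallness conditions hold: `(2·4+1)²e^{−a} ≤ ½` and `#A·(2·4+1)·2·e^{−a} ≤ 1` (`e³⁴ > (27/10)³⁴ > 1.8·10¹³`). -/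
theorem smallness_four_of_card_le {a : ℝ} (ha : 34 ≤ a) {nA : ℝ} (hnA : nA ≤ (10 : ℝ) ^ 12) :
    ((2 * 4 : ℕ) + 1 : ℝ) ^ 2 * Real.exp (-a) ≤ 1 / 2 ∧ nA * (((2 * 4 : ℕ) : ℝ) + 1) * (2 * Real.exp (-a)) ≤ 1 := by
  have he : (18000000000000 : ℝ) < Real.exp 34 := by
    have h1 : (27 / 10 : ℝ) < Real.exp 1 := lt_trans (by norm_num) Real.exp_one_gt_d9
    have h2 : Real.exp 34 = Real.exp 1 ^ 34 := by rw [← Real.exp_nat_mul]; norm_num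
    rw [h2]
    have h3 : (27 / 10 : ℝ) ^ 34 ≤ Real.exp 1 ^ 34 := pow_le_pow_left₀ (by norm_num) h1.le 34
    have h4 : (18000000000000 : ℝ) < (27 / 10 : ℝ) ^ 34 := by norm_num
    linarith
  have hexp : Real.exp (-a) ≤ Real.exp (-34) := Real.exp_le_exp.2 (by linarith)
  have h34 : Real.exp (-34) * Real.exp 34 = 1 := by rw [← Real.exp_add]; norm_num
  have hinv : Real.exp (-34) ≤ 1 / 18000000000000 := by
    rw [le_div_iff₀ (by norm_num : (0:ℝ) < 18000000000000)]
    nlinarith [Real.exp_pos (-34)]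
  have hea : 0 ≤ Real.exp (-a) := (Real.exp_pos _).le
  constructor
  · push_cast
    nlinarith
  · push_cast
    nlinarith

/-- **THE (1.27) FIELD AT A CONVENTION**: for κ₁ ≥ 69 and anchors of at most `10¹²` cubes, the family sum of a box is `≤ e` — «LC-127»'s
`sumY_torus_le_exp_one` on the torus with the readings discharged by construction. [cite: Balaban1988RG2Cluster, (1.27) p.8] -/
theorem sumY_conv {Bg ι : Type} (P : PieceData (doubleCarriers R.carriers) Bg ι (SCube R) (Finset (SCube R)) (SCube R))
    (Yout : ℕ → ι → R.carriers.Dom) (hSY : ∀ k y a, P.SY k y a = famC R 𝔟 k (Yout k y) a)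
    (hvol : ∀ k y a, ∀ b ∈ P.SY k y a, P.vol k y a b = volC R 𝔟 k a b)
    {κ₁ : ℝ} (hκ₁ : 69 ≤ κ₁) (hnA : (𝔟.nA : ℝ) ≤ (10 : ℝ) ^ 12) (k : ℕ) (y : ι) (a : SCube R) :
    ∑ b ∈ P.SY k y a, Real.exp (-(1 / 2) * (κ₁ - 1) * P.vol k y a b) ≤ Real.exp 1 := by
  classical
  have hcard : ((𝔟.anchor k a).card : ℝ) ≤ (10 : ℝ) ^ 12 := le_trans (by exact_mod_cast 𝔟.anchor_card k a) hnA
  have hs := smallness_four_of_card_le (a := (1 / 2) * (κ₁ - 1)) (by linarith) hcard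
  have heq : ∑ b ∈ P.SY k y a, Real.exp (-(1 / 2) * (κ₁ - 1) * P.vol k y a b) =
      ∑ Y ∈ (P.SY k y a).image (cubesOf R k), Real.exp (-((1 / 2) * (κ₁ - 1) * ((Y \ 𝔟.anchor k a).card : ℝ))) := by
    rw [Finset.sum_image (by rw [hSY]; exact injOn_cubesOf_famC k (Yout k y) a)]
    refine Finset.sum_congr rfl fun b hb => ?_
    rw [hvol k y a b hb]; unfold volC; ring_nf
  rw [heq]
  refine sumY_torus_le_exp_one (d := 4) hs.1 (𝔟.anchor_nonempty k a) hs.2 _ fun Y hY => ?_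
  obtain ⟨b, hb, rfl⟩ := Finset.mem_image.1 hY
  rw [hSY] at hb
  obtain ⟨hA, hne, hC, -⟩ := cubesOf_of_mem_famC hb
  exact ⟨hA, hne, hC⟩

/-- **THE LEVEL COUNTS AT A CONVENTION, GENERAL GAIN, LETTERS ONLY** ([II] (1.26)–(1.28)): for any piece frame over the doubled carriers
of record whose index fields are the frame at `𝔟` (read at any `Yout`, `dY ≥ 1 + d`), `LevelCountsG P κ κ₁ (2·(2²⁰+1)) c_Q gain ℓ′` from
κ ≥ 144, κ₁ ≥ 69, `𝔟.nA ≤ 10¹²` and the three gain letters (`𝔟.nW·(L⁴)^{k−j}·gain ≤ c_Q·ℓ′`) — «LC-REC» (`sumX`, `count0`), «LC-WINDOW»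
(`cover`, `countQ`) and §4's `sumY_conv`, every reading discharged by construction. [cite: Balaban1988RG2Cluster, (1.26)-(1.28) p.8] -/
theorem levelCountsG_conv_gain {Bg ι : Type}
    (P : PieceData (doubleCarriers R.carriers) Bg ι (SCube R) (Finset (SCube R)) (SCube R)) (Yout : ℕ → ι → R.carriers.Dom)
    (hS0 : ∀ k y, P.S0 k y = boxes R k (Yout k y)) (hSY : ∀ k y a, P.SY k y a = famC R 𝔟 k (Yout k y) a)
    (hsrc : ∀ k y a j, P.src k y a j = srcC R 𝔟 k a j) (hSq : ∀ k y a j, P.Sq k y a j = cntC R 𝔟 k a j)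
    (hSX : ∀ k y a j q, P.SX k y a j q = fibC R 𝔟 k a j q)
    (hvol : ∀ k y a, ∀ b ∈ P.SY k y a, P.vol k y a b = volC R 𝔟 k a b)
    (hdY : ∀ k y, 1 + R.carriers.d (Yout k y) ≤ P.dY k y)
    {κ κ₁ cQ : ℝ} {gain ℓ' : ℕ → ℕ → ℝ} (hκ : 144 ≤ κ) (hκ₁ : 69 ≤ κ₁) (hnA : (𝔟.nA : ℝ) ≤ (10 : ℝ) ^ 12)
    (hgain : ∀ k j, 0 ≤ gain k j) (hcQℓ : ∀ k j, 0 ≤ cQ * ℓ' k j)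
    (hletters : ∀ k j, j ≤ k → (𝔟.nW : ℝ) * ((R.F.L : ℝ) ^ 4) ^ (k - j) * gain k j ≤ cQ * ℓ' k j) :
    LevelCountsG P κ κ₁ (2 * (2 ^ 20 + 1)) cQ gain ℓ' := by
  have hsrc' : ∀ (k : ℕ) (y : ι) (a : SCube R) (j : ℕ), ∀ x ∈ P.src k y a j,
      j ≤ k ∧ k + R.m' ≤ R.F.m + R.K ∧ x.1 ∈ R.domAt j ∧ ∀ c ∈ footprint x.1, coarsen R c.1 k c.2 ∈ 𝔟.window k a := by
    intro k y a j x hx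
    rw [hsrc] at hx
    obtain ⟨hl, hd, hw⟩ := mem_srcC.1 hx
    exact ⟨hl.1, hl.2, hd, hw⟩
  have hsurj : ∀ (k : ℕ) (y : ι) (a : SCube R) (j : ℕ), j ≤ k → k + R.m' ≤ R.F.m + R.K →
      ∀ b : TPt 4 (R.cubesPerDir j), coarsen R j k b ∈ 𝔟.window k a → ∃ q ∈ P.Sq k y a j, cubeAt R j q = b := by
    intro k y a j hjk hk b hb
    rw [hSq]
    exact ⟨⟨j, b⟩, mem_cntC.2 ⟨⟨hjk, hk⟩, b, hb, rfl⟩, cubeAt_mk R j b⟩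
  have hSXsup : ∀ (k : ℕ) (y : ι) (a : SCube R) (j : ℕ), ∀ q ∈ P.Sq k y a j, ∀ x ∈ P.src k y a j,
      (⟨j, cubeAt R j q⟩ : SCube R) ∈ footprint x.1 → x ∈ P.SX k y a j q := by
    intro k y a j q _ x hx hfp
    rw [hSX]; rw [hsrc] at hx
    exact mem_fibC.2 ⟨hx, hfp⟩
  have hinj : ∀ (k : ℕ) (y : ι) (a : SCube R) (j : ℕ), Set.InjOn (cubeAt R j) ↑(P.Sq k y a j) := by
    intro k y a j q₁ hq₁ q₂ hq₂ h
    rw [hSq] at hq₁ hq₂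
    obtain ⟨-, p₁, -, rfl⟩ := mem_cntC.1 (Finset.mem_coe.1 hq₁)
    obtain ⟨-, p₂, -, rfl⟩ := mem_cntC.1 (Finset.mem_coe.1 hq₂)
    rw [cubeAt_mk, cubeAt_mk] at h
    rw [h]
  have hrq : ∀ (k : ℕ) (y : ι) (a : SCube R) (j : ℕ), ∀ q ∈ P.Sq k y a j,
      j ≤ k ∧ k + R.m' ≤ R.F.m + R.K ∧ coarsen R j k (cubeAt R j q) ∈ 𝔟.window k a := by
    intro k y a j q hq
    rw [hSq] at hq
    obtain ⟨hl, p, hp, rfl⟩ := mem_cntC.1 hq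
    rw [cubeAt_mk]
    exact ⟨hl.1, hl.2, hp⟩
  have h := levelCountsG_of_record R P (m := 2) Prod.fst (fun _ => rfl)
    (fun k y a j q Y => by rw [hSX]; exact multiplicity_fst_le_two _ Y)
    (fun k _ a j q => (⟨j, cubeAt R j q⟩ : SCube R))
    (fun k y a j q x hx => by
      rw [hSX] at hx
      exact ⟨(mem_srcC.1 (mem_fibC.1 hx).1).2.1, (mem_fibC.1 hx).2⟩)
    hκ Yout (fun k y => by rw [hS0]; exact card_boxes_le k (Yout k y)) hdY hκ₁
    (cover_of_window R P Prod.fst (fun k _ a => 𝔟.window k a) (fun k _ a j q => cubeAt R j q) hsrc' hsurj hSXsup)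
    (countQ_of_window R P (fun k _ a => 𝔟.window k a) (w := 𝔟.nW) (fun k _ a => by exact_mod_cast 𝔟.window_card k a)
      (fun k _ a j q => cubeAt R j q) hinj hrq hgain hcQℓ hletters)
    (fun k y a _ => sumY_conv P Yout hSY hvol hκ₁ hnA k y a)
  simpa using h

/-- **THE LEVEL COUNTS AT A CONVENTION IN THE END's LETTERS** (`gain = (agePow θ)⁵`, `ℓ′ = agePow ω`; letters `0 ≤ θ`, `L⁴θ⁵ ≤ ω`,
`𝔟.nW ≤ c_Q`). [cite: Balaban1988RG2Cluster, (1.26)-(1.28) p.8] -/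
theorem levelCountsG_conv {Bg ι : Type}
    (P : PieceData (doubleCarriers R.carriers) Bg ι (SCube R) (Finset (SCube R)) (SCube R)) (Yout : ℕ → ι → R.carriers.Dom)
    (hS0 : ∀ k y, P.S0 k y = boxes R k (Yout k y)) (hSY : ∀ k y a, P.SY k y a = famC R 𝔟 k (Yout k y) a)
    (hsrc : ∀ k y a j, P.src k y a j = srcC R 𝔟 k a j) (hSq : ∀ k y a j, P.Sq k y a j = cntC R 𝔟 k a j)
    (hSX : ∀ k y a j q, P.SX k y a j q = fibC R 𝔟 k a j q)
    (hvol : ∀ k y a, ∀ b ∈ P.SY k y a, P.vol k y a b = volC R 𝔟 k a b)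
    (hdY : ∀ k y, 1 + R.carriers.d (Yout k y) ≤ P.dY k y)
    {κ κ₁ cQ θ ω : ℝ} (hκ : 144 ≤ κ) (hκ₁ : 69 ≤ κ₁) (hnA : (𝔟.nA : ℝ) ≤ (10 : ℝ) ^ 12) (hθ : 0 ≤ θ)
    (hper : (R.F.L : ℝ) ^ 4 * θ ^ 5 ≤ ω) (hw : (𝔟.nW : ℝ) ≤ cQ) :
    LevelCountsG P κ κ₁ (2 * (2 ^ 20 + 1)) cQ (fun k j => agePow θ k j ^ 5) (agePow ω) := by
  have hw0 : 0 ≤ (𝔟.nW : ℝ) := Nat.cast_nonneg _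
  have hL4 : 0 ≤ (R.F.L : ℝ) ^ 4 := pow_nonneg (Nat.cast_nonneg _) 4
  have hω : 0 ≤ ω := le_trans (mul_nonneg hL4 (pow_nonneg hθ 5)) hper
  exact levelCountsG_conv_gain P Yout hS0 hSY hsrc hSq hSX hvol hdY hκ hκ₁ hnA (fun k j => pow_nonneg (pow_nonneg hθ _) 5)
    (fun k j => mul_nonneg (hw0.trans hw) (pow_nonneg hω _))
    (fun k j _ => NE9LevelCountsWindow.letters_of_perLevel hL4 hθ hper hw0 hw k j)

/-! ## §5 The size letter against the paid volume (G1 at a convention) -/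

/-- [folklore] For a family `Y₀` of a box in `Y`: `#cubes_k(Y) ≤ vol + nA + nB` (`Y = Y₀ ∪ □₀`, `Y₀ ⊆ (Y₀ ∖ □̃⁴) ∪ □̃⁴`). -/
theorem card_cubes_le_volC {k : ℕ} {Y : R.carriers.Dom} {a : SCube R} {b : Finset (SCube R)} (hb : b ∈ famC R 𝔟 k Y a) :
    ((cubesOf R k (footprint Y)).card : ℝ) ≤ volC R 𝔟 k a b + 𝔟.nA + 𝔟.nB := by
  obtain ⟨hA, -, -, hU⟩ := cubesOf_of_mem_famC hb
  have h1 : (cubesOf R k (footprint Y)).card ≤ (cubesOf R k b).card + (𝔟.box0 k a).card := by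
    rw [← hU]; exact Finset.card_union_le _ _
  have h2 : (cubesOf R k b).card ≤ (cubesOf R k b \ 𝔟.anchor k a).card + (𝔟.anchor k a).card := by
    calc (cubesOf R k b).card ≤ ((cubesOf R k b \ 𝔟.anchor k a) ∪ 𝔟.anchor k a).card :=
          Finset.card_le_card (by rw [Finset.sdiff_union_of_subset hA])
      _ ≤ (cubesOf R k b \ 𝔟.anchor k a).card + (𝔟.anchor k a).card := Finset.card_union_le _ _
  have h3 := 𝔟.anchor_card k a
  have h4 := 𝔟.box0_card k a
  have : (cubesOf R k (footprint Y)).card ≤ (cubesOf R k b \ 𝔟.anchor k a).card + 𝔟.nA + 𝔟.nB := by omega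
  unfold volC
  exact_mod_cast this

/-- **G1 AT A CONVENTION**: for any box `□` of scale `k` in the output domain `Y` and any family `Y₀` of that box,
`1 + d_k(Y) ≤ (1 + nA + nB) + 4·vol` (`TreeLengthTorus.torusTreeLen_le_card_sub_one` + `Y = Y₀ ∪ □₀`).
[cite: Balaban1988RG2Cluster, (1.25) p.7] -/
theorem one_add_d_le_volC {k : ℕ} {Y : R.carriers.Dom} {a : SCube R} (ha : a ∈ boxes R k Y) {b : Finset (SCube R)}
    (hb : b ∈ famC R 𝔟 k Y a) : 1 + R.carriers.d Y ≤ (1 + 𝔟.nA + 𝔟.nB : ℝ) + 4 * volC R 𝔟 k a b := by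
  obtain ⟨j, Z⟩ := Y
  have hj : j = k := fst_eq_of_mem_boxes ha
  subst hj
  have h1 := card_cubes_le_volC hb
  rw [cubesOf_footprint_mk] at h1
  have h2 : TreeLengthTorus.torusTreeLen Z.1 ≤ (Z.1.card : ℝ) - 1 := TreeLengthTorus.torusTreeLen_le_card_sub_one Z.2.1 Z.2.2
  have h3 : 0 ≤ volC R 𝔟 j a b := by unfold volC; positivity
  rw [TwoRuns.carriers_d]
  change 1 + TreeLengthTorus.torusTreeLen Z.1 ≤ _
  linarith

end Record

end Summit.QuantumFields.BalabanUV.T4Continuum.NE9SpeciesFrameConvention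

end
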